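import Mathlib
import HarnessLib
import Summits.ResolutionOfSingularities.ResolutionOfSingularities.Theorems.WildQuotientsWildQuotientResolutionS1aLogExitFramesCone

/-!
# Line L exit — (F1) part 3 of 3: §6 (F1-loc) ⇒ consumer shape

[OURS · L1 W4.5c · idea-1 g11, v2.1] — NOT statements of the manuscript; counted 0. Part 3 of idea-1's module v2.1
(sha16 6124855f3ff3735d); overview in part 1 `…S1aLogExitFrames`, §5 objects in part 2 `…S1aLogExitFramesCone`.
Crux stmt-ResolutionOfSingularities-17941, line `s1a-logminvertex`, stub `stub_localGame` (EXIT half). This part, REAL: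
`finrank_charKer` (the character lattice has rank `d`), `exists_exitChart_of_charCone` (a closed-point-log-regular
chart of a character cone, pulled back along a `ℤ`-basis of its lattice, is a finitely generated chart monoid,
`NSMulSaturated` in the AMBIENT `ℤ^d` and spanning it, again log regular at the closed point) and the arrow
**`f1LocExit_of_f1Loc : F1Loc p → F1LocExit p`**. Nothing is asserted beyond these proofs.

FILING NOTE (lead-1 g6, LEAD1-GEN6-BRIEF A4): idea-1's module v2.1 (`L/res-L1-w45c-idea-1/f1/tree/…S1aLogExitFrames.lean`,
sha16 6124855f3ff3735d, 799 lines, farm rc 0·0·0·0, tri-1 21:02:21Z PASS) exceeds the 399-line cap and is filed as THREE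
files with declarations byte-identical and in the original order: part 1 `…S1aLogExitFrames` (§1–§4), part 2
`…S1aLogExitFramesCone` (§5), part 3 `…S1aLogExitFramesExit` (§6). All three share the namespace `…S1.LogExitFrames`.
-/

set_option linter.dupNamespace false

noncomputable section

open CategoryTheory AlgebraicGeometry TopologicalSpace
open Literature.AlgebraicGeometry.Resolution

namespace Summit.ResolutionOfSingularities.ResolutionOfSingularities.Theorems.WildQuotientResolution.S1.LogExitFrames

/-! ## §6 (F1-loc) ⇒ consumer shape: re-presenting the character cone in a basis of its lattice (v2.1) -/

section Transport

variable {ι : Type*} [AddCommGroup ι] [Fintype ι] {d : ℕ}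

/-- The `d` vectors `|ι| • e_i` of the character lattice are linearly independent. [OURS · L1 W4.5c] -/
theorem linearIndependent_card_smul_single (χ : Fin d → ι) :
    LinearIndependent ℤ (fun i : Fin d =>
      (⟨((Fintype.card ι : ℕ) : ℤ) • (Pi.single i 1 : Fin d → ℤ), card_smul_mem_charKer χ _⟩ :
        charKer χ)) := by
  apply LinearIndependent.of_comp (charKer χ).subtype
  have hN : ((Fintype.card ι : ℕ) : ℤ) ≠ 0 := by
    have : 0 < Fintype.card ι := Fintype.card_pos_iff.mpr ⟨0⟩
    exact_mod_cast this.ne'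
  rw [Fintype.linearIndependent_iff]
  intro g hg i
  have := congr_fun hg i
  simpa [Finset.sum_apply, Pi.single_apply, hN] using this

/-- The character lattice `L_χ ⊆ ℤ^d` has rank `d` (`|ι|·ℤ^d ⊆ L_χ`). [OURS · L1 W4.5c] -/
theorem finrank_charKer (χ : Fin d → ι) : Module.finrank ℤ (charKer χ) = d := by
  apply le_antisymm
  · simpa [Module.finrank_fin_fun] using Submodule.finrank_le (charKer χ)
  · simpa using (linearIndependent_card_smul_single χ).fintype_card_le_finrank

/-- **Lattice re-presentation of a character-cone chart.** If a chart of the character cone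
`charCone χ ⊆ ℤ^d` into a ring `R` is log regular at the closed point, then — choosing a `ℤ`-basis
of the character lattice `L_χ = charKer χ` (free of rank `d`) and pulling the cone back along
`ψ : ℤ^d ≅ L_χ ⊆ ℤ^d` — `R` carries a chart monoid `P = ψ⁻¹(P_χ) ⊆ ℤ^d` that is finitely generated,
saturated in the AMBIENT `ℤ^d` (`AddSubmonoid.NSMulSaturated`, by `charCone_saturated`) and spans `ℤ^d`
(by `span_charCone_eq_charKer`), with the transported chart `φ ∘ ψ` again log regular at the closed
point (same Kato ideal, unit faces in bijection, equal ranks since `ψ` is injective): exactly the three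
fields `fg / saturated / span_eq_top` of the tree's `LogAtlas` plus `LogChart.IsLogRegularLocal`.
[OURS · L1 W4.5c] -/
theorem exists_exitChart_of_charCone (χ : Fin d → ι) {R : Type*} [CommRing R]
    (φ : Multiplicative (charCone χ) →* R) (hlog : LogChart.IsLogRegularLocal (charCone χ) φ) :
    ∃ P : AddSubmonoid (Fin d → ℤ), P.FG ∧ P.NSMulSaturated ∧
      Submodule.span ℤ (P : Set (Fin d → ℤ)) = ⊤ ∧
      ∃ φ' : Multiplicative P →* R, LogChart.IsLogRegularLocal P φ' := by
  classical
  -- a `ℤ`-basis of the character lattice indexed by `Fin d`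
  obtain ⟨n, b₀⟩ := Submodule.basisOfPid (Pi.basisFun ℤ (Fin d)) (charKer χ)
  have hn : n = d := by
    have h1 : Module.finrank ℤ (charKer χ) = n := by simpa using Module.finrank_eq_card_basis b₀
    rw [← h1, finrank_charKer]
  let b : Module.Basis (Fin d) ℤ (charKer χ) := b₀.reindex (finCongr hn)
  -- `ψ : ℤ^d → ℤ^d`, injective with range `L_χ`
  let ψ : (Fin d → ℤ) →ₗ[ℤ] (Fin d → ℤ) :=
    (charKer χ).subtype ∘ₗ (b.equivFun.symm : (Fin d → ℤ) →ₗ[ℤ] charKer χ)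
  have hψmem : ∀ x, ψ x ∈ charKer χ := fun x => (b.equivFun.symm x).2
  have hψinj : Function.Injective ψ := by
    intro x y hxy
    exact b.equivFun.symm.injective (Subtype.ext hxy)
  have hψsurj : ∀ m ∈ charKer χ, ∃ x, ψ x = m := fun m hm =>
    ⟨b.equivFun ⟨m, hm⟩, by simp [ψ]⟩
  -- the re-presented monoid `P = ψ⁻¹(P_χ)`
  let P : AddSubmonoid (Fin d → ℤ) := (charCone χ).comap ψ.toAddMonoidHom
  have hPmem : ∀ x, x ∈ P ↔ ψ x ∈ charCone χ := fun x => Iff.rfl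
  -- `θ : P → P_χ`, the restriction of `ψ`, is a bijection
  let θ : P →+ charCone χ :=
    (ψ.toAddMonoidHom.restrict P).codRestrict (charCone χ) fun x => (hPmem x).1 x.2
  have hθ : ∀ x : P, ((θ x : charCone χ) : Fin d → ℤ) = ψ x := fun x => rfl
  have hθsurj : Function.Surjective θ := by
    intro m
    obtain ⟨y, hy⟩ := hψsurj m (charCone_le_charKer χ m.2)
    refine ⟨⟨y, (hPmem y).2 (hy ▸ m.2)⟩, Subtype.ext ?_⟩
    rw [hθ]; exact hy
  refine ⟨P, ?_, ?_, ?_, ?_⟩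
  · -- finitely generated: preimage of a finite generating set of `P_χ`
    obtain ⟨T, hT⟩ := charCone_fg χ
    have hTr : (T : Set (Fin d → ℤ)) ⊆ Set.range ψ := fun t ht =>
      hψsurj t (charCone_le_charKer χ (hT ▸ AddSubmonoid.subset_closure ht))
    refine ⟨T.preimage ψ hψinj.injOn, le_antisymm ?_ ?_⟩
    · rw [AddSubmonoid.closure_le]
      intro x hx
      rw [Finset.coe_preimage] at hx
      show ψ x ∈ charCone χ
      rw [← hT]
      exact AddSubmonoid.subset_closure hx
    · intro x hx
      have key : (AddSubmonoid.closure (↑(T.preimage ψ hψinj.injOn) : Set (Fin d → ℤ))).map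
          ψ.toAddMonoidHom = charCone χ := by
        rw [AddMonoidHom.map_mclosure, Finset.coe_preimage, LinearMap.toAddMonoidHom_coe,
          Set.image_preimage_eq_of_subset hTr, hT]
      have hx' : x ∈ ((AddSubmonoid.closure (↑(T.preimage ψ hψinj.injOn) : Set (Fin d → ℤ))).map
          ψ.toAddMonoidHom).comap ψ.toAddMonoidHom := by
        rw [key]; exact hx
      rwa [AddSubmonoid.comap_map_eq_of_injective (by exact hψinj)] at hx'
  · -- saturated in the ambient lattice
    intro k x hkx
    by_cases hk : k = 0
    · exact Or.inl hk
    · refine Or.inr ((hPmem x).2 (charCone_saturated χ hk (hψmem x) ?_))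
      rw [← map_nsmul]
      exact (hPmem _).1 hkx
  · -- spans `ℤ^d`
    rw [eq_top_iff]
    rintro x -
    have himg : ψ '' (P : Set (Fin d → ℤ)) = (charCone χ : Set (Fin d → ℤ)) := by
      ext m
      constructor
      · rintro ⟨y, hy, rfl⟩
        exact (hPmem y).1 hy
      · intro hm
        obtain ⟨y, rfl⟩ := hψsurj m (charCone_le_charKer χ hm)
        exact ⟨y, (hPmem y).2 hm, rfl⟩
    have hx : ψ x ∈ (Submodule.span ℤ (P : Set (Fin d → ℤ))).map ψ := by
      rw [← Submodule.span_image, himg, span_charCone_eq_charKer]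
      exact hψmem x
    obtain ⟨y, hy, hyx⟩ := Submodule.mem_map.1 hx
    exact hψinj hyx ▸ hy
  · -- the transported chart
    let φ' : Multiplicative P →* R := φ.comp (AddMonoidHom.toMultiplicative θ)
    have hφ' : ∀ x : P, φ' (Multiplicative.ofAdd x) = φ (Multiplicative.ofAdd (θ x)) := fun x => rfl
    refine ⟨φ', ?_⟩
    have hI : LogChart.nonunitIdeal P φ' = LogChart.nonunitIdeal (charCone χ) φ := by
      unfold LogChart.nonunitIdeal
      congr 1
      ext r
      constructor
      · rintro ⟨x, hx, rfl⟩
        exact ⟨θ x, hx, (hφ' x).symm⟩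
      · rintro ⟨m, hm, rfl⟩
        obtain ⟨x, rfl⟩ := hθsurj m
        exact ⟨x, hm, hφ' x⟩
    have hF : Module.finrank ℤ (Submodule.span ℤ
          ((fun q : P => (q : Fin d → ℤ)) '' LogChart.unitFace P φ')) =
        Module.finrank ℤ (Submodule.span ℤ
          ((fun q : charCone χ => (q : Fin d → ℤ)) '' LogChart.unitFace (charCone χ) φ)) := by
      have himg : ψ '' ((fun q : P => (q : Fin d → ℤ)) '' LogChart.unitFace P φ') =
          (fun q : charCone χ => (q : Fin d → ℤ)) '' LogChart.unitFace (charCone χ) φ := by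
        ext m
        simp only [Set.mem_image, LogChart.mem_unitFace_iff]
        constructor
        · rintro ⟨_, ⟨x, hx, rfl⟩, rfl⟩
          exact ⟨θ x, hx, hθ x⟩
        · rintro ⟨m, hm, rfl⟩
          obtain ⟨x, rfl⟩ := hθsurj m
          exact ⟨x, ⟨x, hm, rfl⟩, (hθ x).symm⟩
      rw [← himg, Submodule.span_image]
      exact LinearEquiv.finrank_eq (Submodule.equivMapOfInjective ψ hψinj _)
    rw [LogChart.IsLogRegularLocal] at hlog ⊢
    rw [hI, hF]
    exact hlog

/-- **`F1Loc p → F1LocExit p`**: the frame-explicit local lemma implies the consumer (atlas) shape,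
by `exists_exitChart_of_charCone` with `r = d`. [OURS · L1 W4.5c] -/
theorem f1LocExit_of_f1Loc (p : ℕ) (h : F1Loc p) : F1LocExit p := by
  intro hp ι _ _ _ B _ _ 𝒜 _ σ hIT hR hσ hord hne hkill
  obtain ⟨d, _, s, χ, -, -, -, hR₀, φ, -, hlog⟩ := h hp ι B 𝒜 σ hIT hR hσ hord hne hkill
  obtain ⟨P, hfg, hsat, hspan, φ', hlog'⟩ := exists_exitChart_of_charCone χ φ hlog
  exact ⟨hR₀, d, P, hfg, hsat, hspan, φ', hlog'⟩

end Transport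

end Summit.ResolutionOfSingularities.ResolutionOfSingularities.Theorems.WildQuotientResolution.S1.LogExitFrames

end
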